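import Literature.Geometry.Lorentzian.TeukolskyRadialFlux
import Literature.Geometry.Lorentzian.TeukolskyRadialHeunForm
import HarnessLib

/-!
# Growth of the horizon-normalised solution in a classically forbidden region: the convexity of `|R|²`
# for `(Δ R′)′ = q R`, `q ≥ 0`, and the threshold monotonicity of `|R_𝓗|` (scalar Teukolsky / Carter ODE)

Companion of `TeukolskyRadialFlux.lean` (the IMAGINARY part `Δ·Im(R̄ R′)` of `R̄ · ΔR′` is the conserved
`T`-flux) for the REAL part `Δ·Re(R̄ R′) = ½ Δ (|R|²)′`: for a classical solution of the scalar (`s = 0`)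
radial Teukolsky ODE `Δ R″ + 2(r − M)R′ + (K²/Δ − λ − a²ω² + 2amω)R = 0`
(`Kerr.IsRadialTeukolskySolution M a 0 ω m λ R`, R. Teixeira da Costa, CMP 378 (2020) §2.2.3), written in
divergence form `(Δ R′)′ = q R` with the REAL coefficient `q = λ + a²ω² − 2amω − K²/Δ`, one has
`(Re(R̄ · ΔR′))′ = Δ|R′|² + q|R|²`, which is `≥ 0` wherever `q ≥ 0` (classically forbidden region of Carter's
potential). Consequently:

* `monotoneOn_norm_of_divForm` — GENERIC (any `P > 0`, `q ≥ 0` real, `S` complex with `(P S′)′ = q S` on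
  `(α, β]`): if the boundary term `P·Re(S̄ S′)` tends to `0` at `α⁺`, then `P·Re(S̄ S′) ≥ 0` and `x ↦ |S x|`
  is non-decreasing on `(α, β]` (the complex-valued version of the convexity of positive solutions in a
  disconjugate region, Hartman Ch. XI §6; no flux, no sign of `Im`, no size of `ω − mω₊` enters);
  `re_conj_mul_deriv_ge_of_divForm_Icc`, `two_mul_re_conj_mul_deriv_ge_of_divForm_Icc` — the closed-interval form with a
  PERTURBED boundary value `P·Re(S̄S′)(α) ≥ −ε` (then `≥ −ε` throughout and `(|S|²)′ ≥ −2ε/P`), for the regime just off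
  the threshold where the barrier starts at the edge of a small oscillatory cap;
* `tendsto_delta_mul_re_conj_mul_deriv_horizonSolution` — for EVERY radial function normalised at `𝓗⁺` as
  in TdC Def. 2.3 (`Kerr.IsNormalisedHorizonSolution M a 0 ω m R`, `|a| < M`): `Δ(r)·Re(R̄(r) R′(r)) → 0` as
  `r → r₊⁺` (on the collar `R = f·(r − r₊)^ξ` with `Re ξ = 0`, so `Re(R̄R′) = Re(f̄ f′)` EXACTLY — the
  `ξ|f|²/(r − r₊)` term is purely imaginary — and `Δ(r₊) = 0`);
* `radialK_eq_of_threshold`, `sq_radialK_div_delta_le_of_threshold` — AT THE SUPERRADIANT THRESHOLD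
  `ω = mω₊` one has `K = ω(r² − r₊²)` (`K(r₊) = 2Mr₊(ω − mω₊) = 0`), hence
  `K²/Δ = ω²(r − r₊)(r + r₊)²/(r − r₋) ≤ ω²(r + r₊)²` on `r > r₊`;
* `norm_horizonSolution_monotoneOn_of_threshold` — THE THRESHOLD MONOTONICITY: at `ω = mω₊`, for a
  classical solution normalised at `𝓗⁺`, `r ↦ |R(r)|` is non-decreasing on `(r₊, b]` as soon as
  `ω²(b + r₊)² ≤ λ + a²ω² − 2amω` (i.e. up to the far turning point `r + r₊ = √Λ′/|ω|`,
  `Λ′ = Λ − 2amω` with `Λ = λ + a²ω²`; the hypothesis is non-vacuous exactly in the Breitenlohner–Freedman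
  STABLE sectors `Λ′ > 4r₊²ω²` of the near-extremal throat), together with the weighted form
  `norm_u_horizonSolution_le_of_threshold` for `u = (r² + a²)^{1/2} R` and the sign
  `re_conj_mul_deriv_horizonSolution_nonneg_of_threshold` (`Re(R̄ R′) ≥ 0`: the horizon solution is
  OUTWARD-GROWING all along the barrier, i.e. it is dominated by the growing branch — the threshold case of
  the tunnelling estimates for the cone Green kernel `u_𝓗(r)u_𝓘(r′)/𝔚` of the near-extremal Kerr programme,
  crux `KappaExplicitWaveDecay`, where it replaces the flux lower bound `|α₊||α₋| ≥ |ω − mω₊|/W(e₊,e₋)`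
  that degenerates as `ω → mω₊`).

Everything is proved; theorems only. Not here: anything off the threshold (`ω ≠ mω₊`: then `K²/Δ → +∞`
at `r₊` and a small oscillatory cap `(r₊, r₊ + O((ω − mω₊)²))` precedes the barrier), the spin-weighted
case `s ≠ 0`, the extremal case `|a| = M`.

## References
* R. Teixeira da Costa, *Mode stability for the Teukolsky equation on extremal and subextremal Kerr
  spacetimes*, CMP 378 (2020) 705–781 = arXiv:1910.02854: §2.2.1 (`ξ`, `ω₊`), §2.2.3 (radial ODE),
  Def. 2.3 (normalised `R_{𝓗⁺}`), Prop. 2.20. [Costa2019]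
* M. Dafermos, I. Rodnianski, Y. Shlapentokh-Rothman, *Decay for solutions of the wave equation on Kerr
  exterior spacetimes III*, Ann. of Math. 183 (2016) = arXiv:1402.7034: §5.2.3 (Carter's equation),
  §6 (the potential and its forbidden regions). [DafermosRodnianskiShlapentokhrothman2014]
* P. Hartman, *Ordinary Differential Equations*, SIAM Classics 38 (2002), Ch. XI §6 (disconjugacy;
  convexity of positive solutions when `q ≥ 0`). [Hartman2002]
-/

noncomputable section

open Complex Set Filter Topology
open scoped ComplexConjugate

namespace Literature.Geometry.Lorentzian.Kerr

namespace Costa2019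

/-! ### Algebra of `Re(z̄ · (p w))` -/

/-- `Re(z̄ · (p·w)) = p · Re(z̄ w)` for real `p`. [folklore] -/
private theorem re_conj_mul_ofReal_mul (z w : ℂ) (p : ℝ) :
    (conj z * ((p : ℂ) * w)).re = p * (conj z * w).re := by
  rw [mul_left_comm, Complex.re_ofReal_mul]

/-- `Re(z̄ · (p·z)) = p · |z|²` for real `p`. [folklore] -/
private theorem re_conj_mul_ofReal_mul_self (z : ℂ) (p : ℝ) :
    (conj z * ((p : ℂ) * z)).re = p * ‖z‖ ^ 2 := by
  rw [re_conj_mul_ofReal_mul, Complex.conj_mul']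
  norm_cast

/-- `Re(z̄ w) = Re(w̄ z)`. [folklore] -/
private theorem re_conj_mul_comm (z w : ℂ) : (conj z * w).re = (conj w * z).re := by
  simp [Complex.mul_re]; ring

/-! ### The generic convexity / monotonicity lemma for `(P S′)′ = q S`, `q ≥ 0` -/

/-- **Growth in a forbidden region (complex solutions, divergence form).** On `(α, β]` let `S : ℝ → ℂ`
be differentiable with derivative `S′`, let `P, q : ℝ → ℝ` with `P > 0`, `q ≥ 0`, and suppose
`x ↦ P(x)·S′(x)` is differentiable with derivative `q(x)·S(x)` (the equation `(P S′)′ = q S`). If the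
boundary term `P·Re(S̄ S′)` tends to `0` as `x → α⁺`, then (i) `P(x)·Re(S̄(x) S′(x)) ≥ 0` on `(α, β]`
— since `(Re(S̄ · P S′))′ = P|S′|² + q|S|² ≥ 0` — and (ii) `x ↦ |S(x)|` is non-decreasing on `(α, β]`
(`(|S|²)′ = 2 Re(S̄ S′) ≥ 0`). [folklore] -/
theorem re_conj_mul_deriv_nonneg_of_divForm {α β : ℝ} {P q : ℝ → ℝ} {S S' : ℝ → ℂ}
    (hS : ∀ x ∈ Ioc α β, HasDerivAt S (S' x) x)
    (hT : ∀ x ∈ Ioc α β, HasDerivAt (fun y ↦ (P y : ℂ) * S' y) ((q x : ℂ) * S x) x)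
    (hq : ∀ x ∈ Ioc α β, 0 ≤ q x) (hP : ∀ x ∈ Ioc α β, 0 ≤ P x)
    (h0 : Tendsto (fun x ↦ P x * (conj (S x) * S' x).re) (𝓝[>] α) (𝓝 0)) :
    ∀ x ∈ Ioc α β, 0 ≤ P x * (conj (S x) * S' x).re := by
  -- `g = Re(S̄ · (P S′))`, `g′ = P|S′|² + q|S|² ≥ 0`
  set g : ℝ → ℝ := fun x ↦ (conj (S x) * ((P x : ℂ) * S' x)).re with hg
  have hg' : ∀ x ∈ Ioc α β, HasDerivAt g (P x * ‖S' x‖ ^ 2 + q x * ‖S x‖ ^ 2) x := by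
    intro x hx
    have h1 : HasDerivAt (fun y ↦ conj (S y) * ((P y : ℂ) * S' y))
        (conj (S' x) * ((P x : ℂ) * S' x) + conj (S x) * ((q x : ℂ) * S x)) x :=
      (hS x hx).star.mul (hT x hx)
    have h2 := Complex.reCLM.hasFDerivAt.comp_hasDerivAt x h1
    have h3 : (Complex.reCLM : ℂ → ℝ) ∘ (fun y ↦ conj (S y) * ((P y : ℂ) * S' y)) = g := by
      funext y; simp [hg]
    rw [h3] at h2
    refine h2.congr_deriv ?_
    rw [Complex.reCLM_apply, Complex.add_re, re_conj_mul_ofReal_mul_self,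
      re_conj_mul_ofReal_mul_self]
  have hmono : MonotoneOn g (Ioc α β) :=
    monotoneOn_of_deriv_nonneg (convex_Ioc α β)
      (fun x hx ↦ (hg' x hx).continuousAt.continuousWithinAt)
      (fun x hx ↦ (hg' x (interior_subset hx)).differentiableAt.differentiableWithinAt)
      fun x hx ↦ by
        have hx' : x ∈ Ioc α β := interior_subset hx
        rw [(hg' x hx').deriv]
        exact add_nonneg (mul_nonneg (hP x hx') (sq_nonneg _)) (mul_nonneg (hq x hx') (sq_nonneg _))
  have hgP : ∀ x, g x = P x * (conj (S x) * S' x).re := fun x ↦ re_conj_mul_ofReal_mul _ _ _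
  have h0' : Tendsto g (𝓝[>] α) (𝓝 0) := h0.congr fun x ↦ (hgP x).symm
  intro x hx
  rw [← hgP]
  refine le_of_tendsto h0' ?_
  filter_upwards [Ioo_mem_nhdsGT hx.1] with t ht
  exact hmono ⟨ht.1, ht.2.le.trans hx.2⟩ hx ht.2.le

/-- **Growth in a forbidden region, perturbed boundary value (closed interval).** On `[α, β]` let
`(P S′)′ = q S` with `P ≥ 0`, `q ≥ 0` (pointwise `HasDerivAt` data at every point of `[α, β]`). Then the quantity
`g = P·Re(S̄ S′)` is non-decreasing on `[α, β]`; in particular if `g(α) ≥ −ε` then `g ≥ −ε` on `[α, β]` — the form used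
just off the superradiant threshold, where the barrier starts at the edge `α` of a small oscillatory cap on which
`|g(α)| ≲ |ω − mω₊|/κ` instead of `0`. [folklore] -/
theorem re_conj_mul_deriv_ge_of_divForm_Icc {α β ε : ℝ} {P q : ℝ → ℝ} {S S' : ℝ → ℂ}
    (hS : ∀ x ∈ Icc α β, HasDerivAt S (S' x) x)
    (hT : ∀ x ∈ Icc α β, HasDerivAt (fun y ↦ (P y : ℂ) * S' y) ((q x : ℂ) * S x) x)
    (hq : ∀ x ∈ Icc α β, 0 ≤ q x) (hP : ∀ x ∈ Icc α β, 0 ≤ P x)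
    (h0 : -ε ≤ P α * (conj (S α) * S' α).re) :
    ∀ x ∈ Icc α β, -ε ≤ P x * (conj (S x) * S' x).re := by
  set g : ℝ → ℝ := fun x ↦ (conj (S x) * ((P x : ℂ) * S' x)).re with hg
  have hg' : ∀ x ∈ Icc α β, HasDerivAt g (P x * ‖S' x‖ ^ 2 + q x * ‖S x‖ ^ 2) x := by
    intro x hx
    have h1 : HasDerivAt (fun y ↦ conj (S y) * ((P y : ℂ) * S' y))
        (conj (S' x) * ((P x : ℂ) * S' x) + conj (S x) * ((q x : ℂ) * S x)) x :=
      (hS x hx).star.mul (hT x hx)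
    have h2 := Complex.reCLM.hasFDerivAt.comp_hasDerivAt x h1
    have h3 : (Complex.reCLM : ℂ → ℝ) ∘ (fun y ↦ conj (S y) * ((P y : ℂ) * S' y)) = g := by
      funext y; simp [hg]
    rw [h3] at h2
    refine h2.congr_deriv ?_
    rw [Complex.reCLM_apply, Complex.add_re, re_conj_mul_ofReal_mul_self,
      re_conj_mul_ofReal_mul_self]
  have hmono : MonotoneOn g (Icc α β) :=
    monotoneOn_of_deriv_nonneg (convex_Icc α β)
      (fun x hx ↦ (hg' x hx).continuousAt.continuousWithinAt)
      (fun x hx ↦ (hg' x (interior_subset hx)).differentiableAt.differentiableWithinAt)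
      fun x hx ↦ by
        have hx' : x ∈ Icc α β := interior_subset hx
        rw [(hg' x hx').deriv]
        exact add_nonneg (mul_nonneg (hP x hx') (sq_nonneg _)) (mul_nonneg (hq x hx') (sq_nonneg _))
  have hgP : ∀ x, g x = P x * (conj (S x) * S' x).re := fun x ↦ re_conj_mul_ofReal_mul _ _ _
  intro x hx
  have hαx : α ≤ x := hx.1
  have h := hmono (left_mem_Icc.2 (hx.1.trans hx.2)) hx hαx
  rw [hgP, hgP] at h
  linarith

/-- **Quasi-monotonicity of `|S|²` under a perturbed boundary value.** Under the hypotheses of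
`re_conj_mul_deriv_ge_of_divForm_Icc` with `P > 0` on `[α, β]`: for `α ≤ x ≤ y ≤ β`,
`|S(x)|² ≤ |S(y)|² + 2ε·∫_x^y dt/P(t)` in the differential form `(|S|²)′ ≥ −2ε/P`; recorded here as the pointwise
derivative inequality `2·Re(S̄ S′)(x) ≥ −2ε/P(x)`. [folklore] -/
theorem two_mul_re_conj_mul_deriv_ge_of_divForm_Icc {α β ε : ℝ} {P q : ℝ → ℝ} {S S' : ℝ → ℂ}
    (hS : ∀ x ∈ Icc α β, HasDerivAt S (S' x) x)
    (hT : ∀ x ∈ Icc α β, HasDerivAt (fun y ↦ (P y : ℂ) * S' y) ((q x : ℂ) * S x) x)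
    (hq : ∀ x ∈ Icc α β, 0 ≤ q x) (hP : ∀ x ∈ Icc α β, 0 < P x)
    (h0 : -ε ≤ P α * (conj (S α) * S' α).re) {x : ℝ} (hx : x ∈ Icc α β) :
    -(2 * ε / P x) ≤ 2 * (conj (S x) * S' x).re := by
  have h := re_conj_mul_deriv_ge_of_divForm_Icc hS hT hq (fun t ht ↦ (hP t ht).le) h0 x hx
  have hPx := hP x hx
  rw [neg_le, le_div_iff₀ hPx]
  nlinarith

/-- **Monotonicity of `|S|` in a forbidden region** — part (ii) of the previous lemma: under the same
hypotheses with `P > 0`, `x ↦ |S(x)|` is non-decreasing on `(α, β]`. [folklore] -/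
theorem monotoneOn_norm_of_divForm {α β : ℝ} {P q : ℝ → ℝ} {S S' : ℝ → ℂ}
    (hS : ∀ x ∈ Ioc α β, HasDerivAt S (S' x) x)
    (hT : ∀ x ∈ Ioc α β, HasDerivAt (fun y ↦ (P y : ℂ) * S' y) ((q x : ℂ) * S x) x)
    (hq : ∀ x ∈ Ioc α β, 0 ≤ q x) (hP : ∀ x ∈ Ioc α β, 0 < P x)
    (h0 : Tendsto (fun x ↦ P x * (conj (S x) * S' x).re) (𝓝[>] α) (𝓝 0)) :
    MonotoneOn (fun x ↦ ‖S x‖) (Ioc α β) := by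
  have hpos := re_conj_mul_deriv_nonneg_of_divForm hS hT hq (fun x hx ↦ (hP x hx).le) h0
  -- `n = |S|² = Re(S̄ S)` has derivative `2 Re(S̄ S′) ≥ 0`
  set n : ℝ → ℝ := fun x ↦ ‖S x‖ ^ 2 with hn
  have hn' : ∀ x ∈ Ioc α β, HasDerivAt n (2 * (conj (S x) * S' x).re) x := by
    intro x hx
    have h1 : HasDerivAt (fun y ↦ conj (S y) * S y) (conj (S' x) * S x + conj (S x) * S' x) x :=
      (hS x hx).star.mul (hS x hx)
    have h2 := Complex.reCLM.hasFDerivAt.comp_hasDerivAt x h1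
    have h3 : (Complex.reCLM : ℂ → ℝ) ∘ (fun y ↦ conj (S y) * S y) = n := by
      funext y
      simp only [Function.comp_apply, Complex.reCLM_apply, hn, Complex.conj_mul']
      norm_cast
    rw [h3] at h2
    refine h2.congr_deriv ?_
    rw [Complex.reCLM_apply, Complex.add_re, re_conj_mul_comm (S' x) (S x)]
    ring
  have hmono : MonotoneOn n (Ioc α β) :=
    monotoneOn_of_deriv_nonneg (convex_Ioc α β)
      (fun x hx ↦ (hn' x hx).continuousAt.continuousWithinAt)
      (fun x hx ↦ (hn' x (interior_subset hx)).differentiableAt.differentiableWithinAt)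
      fun x hx ↦ by
        have hx' : x ∈ Ioc α β := interior_subset hx
        rw [(hn' x hx').deriv]
        have h := hpos x hx'
        have hPx := hP x hx'
        have : 0 ≤ (conj (S x) * S' x).re := by
          by_contra hneg
          push Not at hneg
          have : P x * (conj (S x) * S' x).re < 0 := mul_neg_of_pos_of_neg hPx hneg
          linarith
        linarith
  intro x hx y hy hxy
  have h := hmono hx hy hxy
  simp only [hn] at h
  exact (pow_le_pow_iff_left₀ (norm_nonneg _) (norm_nonneg _) two_ne_zero).1 h

/-! ### The boundary term at `𝓗⁺` vanishes for every normalised horizon solution -/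

/-- **Collar identity, real part.** If `R = f·(y − rp)^ξ` near `y > rp` with `Re ξ = 0` and `f`
differentiable at `y`, then `Re(R̄(y) R′(y)) = Re(f̄(y) f′(y))`: in
`R̄ R′ = f̄ f′ + ξ|f|²/(y − rp)` (the weight has modulus one) the second term is purely imaginary.
[folklore] -/
private theorem re_conj_mul_deriv_of_factor {R f : ℝ → ℂ} {rp y : ℝ} {ξ f' : ℂ} (hy : rp < y)
    (hξ : ξ.re = 0) (hf : HasDerivAt f f' y)
    (hRf : ∀ᶠ t in 𝓝 y, R t = f t * ((t - rp : ℝ) : ℂ) ^ ξ) :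
    (conj (R y) * deriv R y).re = (conj (f y) * f').re := by
  have ht : (0 : ℝ) < y - rp := sub_pos.2 hy
  have hT : ((y - rp : ℝ) : ℂ) ≠ 0 := by exact_mod_cast ht.ne'
  set Pw : ℂ := ((y - rp : ℝ) : ℂ) ^ ξ with hPw
  have e1 : conj Pw * Pw = 1 := by
    rw [Complex.conj_mul', Complex.norm_cpow_eq_rpow_re_of_pos ht, hξ, Real.rpow_zero]
    simp
  have hR : HasDerivAt R (f' * Pw + f y * (Pw * (ξ / ((y - rp : ℝ) : ℂ)))) y :=
    (hf.mul (hasDerivAt_ofReal_sub_cpow rp ξ hy)).congr_of_eventuallyEq hRf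
  have hRy : R y = f y * Pw := hRf.self_of_nhds
  have key : conj (R y) * deriv R y =
      conj (f y) * f' + ξ * (conj (f y) * f y) * ((y - rp : ℝ) : ℂ)⁻¹ := by
    rw [hR.deriv, hRy, map_mul, div_eq_mul_inv]
    linear_combination (conj (f y) * f' + ξ * conj (f y) * f y * ((y - rp : ℝ) : ℂ)⁻¹) * e1
  rw [key, Complex.add_re]
  have him : (ξ * (conj (f y) * f y) * ((y - rp : ℝ) : ℂ)⁻¹).re = 0 := by
    rw [Complex.conj_mul', ← Complex.ofReal_pow, ← Complex.ofReal_inv, mul_assoc,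
      ← Complex.ofReal_mul, Complex.re_mul_ofReal, hξ, zero_mul]
  rw [him, add_zero]

/-- **The `𝓗⁺` boundary term of the real part vanishes** (`s = 0`, `|a| < M`, ANY real `ω`): for a
radial function normalised at `𝓗⁺` as in TdC Def. 2.3 (`R(r)(r − r₊)^{−ξ} = f(r)` smooth at `r₊`),
`Δ(r)·Re(R̄(r) R′(r)) → 0` as `r → r₊⁺`: on the collar `Re(R̄R′) = Re(f̄ f′)` (the weight `(r − r₊)^ξ`,
`Re ξ = 0`, contributes only to the imaginary part — the flux `−(ω − mω₊)` of
`radialFlux_eq_of_normalisedHorizon`), `f, f′` are continuous at `r₊` and `Δ(r₊) = 0`.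
[cite: Costa2019, Definition 2.3] -/
theorem tendsto_delta_mul_re_conj_mul_deriv_horizonSolution {M a ω m : ℝ} (ha : |a| < M)
    {R : ℝ → ℂ} (hn : IsNormalisedHorizonSolution M a 0 ω m R) :
    Tendsto (fun r ↦ delta M a r * (conj (R r) * deriv R r).re) (𝓝[>] (rPlus M a)) (𝓝 0) := by
  obtain ⟨ε, hε, f, hf, hRf, -⟩ := hn
  set ξ : ℂ := horizonExponent M a ω m with hξ
  have hξre : ξ.re = 0 := horizonExponent_re M a ω m
  have htop : ((⊤ : ℕ∞) : WithTop ℕ∞) ≠ 0 := by simp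
  have hfd : ContDiffOn ℝ ((⊤ : ℕ∞) : WithTop ℕ∞) (deriv f) (Ioo (rPlus M a - ε) (rPlus M a + ε)) :=
    hf.deriv_of_isOpen isOpen_Ioo (by simp)
  -- `R = f · (y − r₊)^ξ` on the collar
  have hfac : ∀ y ∈ Ioo (rPlus M a) (rPlus M a + ε),
      R y = f y * ((y - rPlus M a : ℝ) : ℂ) ^ ξ := by
    intro y hy
    have hT : ((y - rPlus M a : ℝ) : ℂ) ≠ 0 := by exact_mod_cast (sub_pos.2 hy.1).ne'
    have hPne : ((y - rPlus M a : ℝ) : ℂ) ^ ξ ≠ 0 := fun h0 =>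
      hT (Complex.cpow_eq_zero_iff _ _ |>.1 h0).1
    have h := hRf y hy
    rw [Complex.ofReal_zero, zero_sub, Complex.cpow_neg] at h
    rw [← h, mul_assoc, inv_mul_cancel₀ hPne, mul_one]
  -- on the collar the real part is `Δ · Re(f̄ f′)`
  have hcollar : ∀ y ∈ Ioo (rPlus M a) (rPlus M a + ε),
      delta M a y * (conj (R y) * deriv R y).re = delta M a y * (conj (f y) * deriv f y).re := by
    intro y hy
    have hyI : Ioo (rPlus M a - ε) (rPlus M a + ε) ∈ 𝓝 y :=
      Ioo_mem_nhds (by linarith [hy.1]) hy.2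
    have hfy : HasDerivAt f (deriv f y) y :=
      ((hf.differentiableOn htop y ⟨by linarith [hy.1], hy.2⟩).differentiableAt hyI).hasDerivAt
    have hev : ∀ᶠ t in 𝓝 y, R t = f t * ((t - rPlus M a : ℝ) : ℂ) ^ ξ := by
      filter_upwards [Ioo_mem_nhds hy.1 hy.2] with t ht using hfac t ht
    rw [re_conj_mul_deriv_of_factor hy.1 hξre hfy hev]
  -- the limit by continuity of `f, f′` at `r₊` and `Δ(r₊) = 0`
  set h : ℝ → ℝ := fun y ↦ delta M a y * (conj (f y) * deriv f y).re with hh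
  have hI0 : Ioo (rPlus M a - ε) (rPlus M a + ε) ∈ 𝓝 (rPlus M a) :=
    Ioo_mem_nhds (by linarith) (by linarith)
  have hfc : ContinuousAt f (rPlus M a) := hf.continuousOn.continuousAt hI0
  have hf'c : ContinuousAt (deriv f) (rPlus M a) := hfd.continuousOn.continuousAt hI0
  have hΔc : Continuous (delta M a) :=
    show Continuous fun y : ℝ ↦ y ^ 2 - 2 * M * y + a ^ 2 by fun_prop
  have hcont : ContinuousAt h (rPlus M a) := by
    have h1 : ContinuousAt (fun y ↦ (conj (f y) * deriv f y).re) (rPlus M a) :=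
      Complex.continuous_re.continuousAt.comp
        ((Complex.continuous_conj.continuousAt.comp hfc).mul hf'c)
    exact hΔc.continuousAt.mul h1
  have hval : h (rPlus M a) = 0 := by
    simp only [hh, delta_rPlus ha.le, zero_mul]
  have hlim : Tendsto h (𝓝[>] rPlus M a) (𝓝 0) := by
    rw [← hval]
    exact hcont.tendsto.mono_left nhdsWithin_le_nhds
  refine hlim.congr' ?_
  filter_upwards [Ioo_mem_nhdsGT (show rPlus M a < rPlus M a + ε by linarith)] with y hy
  exact (hcollar y hy).symm

/-! ### At the threshold `ω = mω₊`: `K = ω(r² − r₊²)` and `K²/Δ ≤ ω²(r + r₊)²` -/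

/-- At the superradiant threshold `ω = mω₊ = ma/(2Mr₊)` (`|a| < M`):
`K(r) = ω(r² + a²) − am = ω(r² − r₊²)` (since `am = 2Mr₊ω = (r₊² + a²)ω`). [folklore] -/
theorem radialK_eq_of_threshold {M a ω m : ℝ} (ha : |a| < M)
    (hω : ω = m * horizonAngularVelocity M a) (r : ℝ) :
    radialK a ω m r = ω * (r ^ 2 - rPlus M a ^ 2) := by
  have hM : 0 < M := lt_of_le_of_lt (abs_nonneg a) ha
  have hrp : 0 < rPlus M a := rPlus_pos hM a
  have h2 : 2 * M * rPlus M a ≠ 0 := by positivity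
  have ham : a * m = ω * (rPlus M a ^ 2 + a ^ 2) := by
    rw [rPlus_sq_add_sq ha.le, hω, horizonAngularVelocity]
    field_simp
  rw [radialK, ham]
  ring

/-- At the threshold `ω = mω₊` (`|a| < M`), for `r > r₊`:
`K²/Δ = ω²(r − r₊)(r + r₊)²/(r − r₋) ≤ ω²(r + r₊)²` (`Δ = (r − r₊)(r − r₋)`, `0 < r − r₊ < r − r₋`).
[folklore] -/
theorem sq_radialK_div_delta_le_of_threshold {M a ω m : ℝ} (ha : |a| < M)
    (hω : ω = m * horizonAngularVelocity M a) {r : ℝ} (hr : rPlus M a < r) :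
    radialK a ω m r ^ 2 / delta M a r ≤ ω ^ 2 * (r + rPlus M a) ^ 2 := by
  have hsub : IsSubextremal M a := ha
  have hlt : rMinus M a < rPlus M a := hsub.rMinus_lt_rPlus
  have h1 : 0 < r - rPlus M a := sub_pos.2 hr
  have h2 : 0 < r - rMinus M a := by linarith
  have hΔ : 0 < delta M a r := delta_pos ha.le hr
  rw [div_le_iff₀ hΔ, radialK_eq_of_threshold ha hω, delta_eq_mul ha.le]
  have h3 : r - rPlus M a ≤ r - rMinus M a := by linarith
  have key : (ω * (r ^ 2 - rPlus M a ^ 2)) ^ 2 =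
      ω ^ 2 * (r + rPlus M a) ^ 2 * ((r - rPlus M a) * (r - rPlus M a)) := by ring
  rw [key]
  exact mul_le_mul_of_nonneg_left (mul_le_mul_of_nonneg_left h3 h1.le) (by positivity)

/-! ### The threshold monotonicity of `|R_𝓗|` -/

/-- **Divergence form of the scalar radial Teukolsky ODE.** For a classical solution `R` (`s = 0`, real
`ω, m, λ`) with derivative witnesses `R′, R″` on `r > r₊`: `r ↦ Δ(r) R′(r)` has derivative
`(λ + a²ω² − 2amω − K²/Δ)·R` at every `r > r₊` (`Δ′ = 2(r − M)`). [cite: Costa2019, §2.2.3 (radial ODE)] -/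
theorem hasDerivAt_delta_mul_deriv {M a ω m lam : ℝ} {R R' R'' : ℝ → ℂ}
    (hR : ∀ r : ℝ, rPlus M a < r →
      HasDerivAt R (R' r) r ∧ HasDerivAt R' (R'' r) r ∧
        (delta M a r : ℂ) * R'' r + 2 * ((0 + 1 : ℝ) : ℂ) * ((r - M : ℝ) : ℂ) * R' r +
          ((((radialK a ω m r ^ 2 : ℝ) : ℂ) -
                2 * I * ((0 : ℝ) : ℂ) * ((r - M : ℝ) : ℂ) * (radialK a ω m r : ℂ)) / (delta M a r : ℂ) +
              4 * I * ((0 : ℝ) : ℂ) * (ω : ℂ) * (r : ℂ) - (lam : ℂ) - ((a ^ 2 * ω ^ 2 : ℝ) : ℂ) +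
              ((2 * a * m * ω : ℝ) : ℂ)) * R r = 0)
    {r : ℝ} (hr : rPlus M a < r) :
    HasDerivAt (fun y ↦ (delta M a y : ℂ) * R' y)
      (((lam + a ^ 2 * ω ^ 2 - 2 * a * m * ω - radialK a ω m r ^ 2 / delta M a r : ℝ) : ℂ) * R r) r := by
  obtain ⟨-, h2, hode⟩ := hR r hr
  have hD := ((hasDerivAt_delta M a r).ofReal_comp).mul h2
  refine hD.congr_deriv ?_
  push_cast at hode ⊢
  linear_combination hode

/-- **Threshold monotonicity of the horizon-normalised solution** (`s = 0`, `|a| < M`). At the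
superradiant threshold `ω = mω₊`, let `R` be a classical solution of the scalar radial Teukolsky ODE with
TdC's parameter `λ` (`Kerr.IsRadialTeukolskySolution M a 0 ω m λ R`) normalised at `𝓗⁺` as in Def. 2.3
(`Kerr.IsNormalisedHorizonSolution M a 0 ω m R`: the regular Frobenius branch, `ξ = 0`). If
`ω²(b + r₊)² ≤ λ + a²ω² − 2amω` (no turning point of the divergence-form coefficient
`q = λ + a²ω² − 2amω − K²/Δ ≥ λ + a²ω² − 2amω − ω²(r + r₊)²` on `(r₊, b]`), then `r ↦ |R(r)|` is
NON-DECREASING on `(r₊, b]`: the horizon solution grows monotonically across the whole forbidden region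
that starts at the horizon (Breitenlohner–Freedman stable sectors `Λ − 2amω > 4r₊²ω²` of the near-extremal
throat, with `b + r₊ = √(Λ − 2amω)/|ω|`). [folklore] -/
theorem norm_horizonSolution_monotoneOn_of_threshold {M a ω m lam : ℝ} (ha : |a| < M) {R : ℝ → ℂ}
    (hsol : IsRadialTeukolskySolution M a 0 ω m lam R) (hn : IsNormalisedHorizonSolution M a 0 ω m R)
    (hω : ω = m * horizonAngularVelocity M a) {b : ℝ}
    (hb : ω ^ 2 * (b + rPlus M a) ^ 2 ≤ lam + a ^ 2 * ω ^ 2 - 2 * a * m * ω) :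
    MonotoneOn (fun r ↦ ‖R r‖) (Ioc (rPlus M a) b) := by
  have hM : 0 < M := lt_of_le_of_lt (abs_nonneg a) ha
  have hrp : 0 < rPlus M a := rPlus_pos hM a
  obtain ⟨R', R'', hR⟩ := hsol
  have hderiv : ∀ r, rPlus M a < r → deriv R r = R' r := fun r hr ↦ (hR r hr).1.deriv
  refine monotoneOn_norm_of_divForm (P := delta M a)
    (q := fun r ↦ lam + a ^ 2 * ω ^ 2 - 2 * a * m * ω - radialK a ω m r ^ 2 / delta M a r)
    (S' := R') (fun x hx ↦ (hR x hx.1).1) (fun x hx ↦ hasDerivAt_delta_mul_deriv hR hx.1)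
    (fun x hx ↦ ?_) (fun x hx ↦ delta_pos ha.le hx.1) ?_
  · -- `q ≥ 0` on `(r₊, b]`: `K²/Δ ≤ ω²(x + r₊)² ≤ ω²(b + r₊)² ≤ Λ′`
    have h1 := sq_radialK_div_delta_le_of_threshold ha hω hx.1
    have h2 : ω ^ 2 * (x + rPlus M a) ^ 2 ≤ ω ^ 2 * (b + rPlus M a) ^ 2 := by
      have hx0 : 0 ≤ x + rPlus M a := by linarith [hx.1]
      have hxb : x + rPlus M a ≤ b + rPlus M a := by linarith [hx.2]
      exact mul_le_mul_of_nonneg_left (pow_le_pow_left₀ hx0 hxb 2) (sq_nonneg ω)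
    show 0 ≤ lam + a ^ 2 * ω ^ 2 - 2 * a * m * ω - radialK a ω m x ^ 2 / delta M a x
    linarith
  · -- the boundary term: `Δ·Re(R̄ R′) → 0` with `R′ = deriv R` on `(r₊, ∞)`
    refine (tendsto_delta_mul_re_conj_mul_deriv_horizonSolution ha hn).congr' ?_
    filter_upwards [self_mem_nhdsWithin] with y hy
    rw [hderiv y hy]

/-- **The horizon solution is outward-growing along the threshold barrier**: under the hypotheses of
`norm_horizonSolution_monotoneOn_of_threshold`, `Re(R̄(r)·R′(r)) ≥ 0` (equivalently `(|R|²)′(r) ≥ 0`)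
for every `r ∈ (r₊, b]`. [folklore] -/
theorem re_conj_mul_deriv_horizonSolution_nonneg_of_threshold {M a ω m lam : ℝ} (ha : |a| < M)
    {R : ℝ → ℂ} (hsol : IsRadialTeukolskySolution M a 0 ω m lam R)
    (hn : IsNormalisedHorizonSolution M a 0 ω m R) (hω : ω = m * horizonAngularVelocity M a) {b : ℝ}
    (hb : ω ^ 2 * (b + rPlus M a) ^ 2 ≤ lam + a ^ 2 * ω ^ 2 - 2 * a * m * ω)
    {r : ℝ} (hr : rPlus M a < r) (hrb : r ≤ b) :
    0 ≤ (conj (R r) * deriv R r).re := by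
  have hM : 0 < M := lt_of_le_of_lt (abs_nonneg a) ha
  have hrp : 0 < rPlus M a := rPlus_pos hM a
  obtain ⟨R', R'', hR⟩ := hsol
  have hderiv : ∀ r, rPlus M a < r → deriv R r = R' r := fun r hr ↦ (hR r hr).1.deriv
  have h := re_conj_mul_deriv_nonneg_of_divForm (α := rPlus M a) (β := b) (P := delta M a)
    (q := fun r ↦ lam + a ^ 2 * ω ^ 2 - 2 * a * m * ω - radialK a ω m r ^ 2 / delta M a r)
    (S' := R') (fun x hx ↦ (hR x hx.1).1) (fun x hx ↦ hasDerivAt_delta_mul_deriv hR hx.1)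
    (fun x hx ↦ ?_) (fun x hx ↦ (delta_pos ha.le hx.1).le) ?_ r ⟨hr, hrb⟩
  · rw [hderiv r hr]
    have hΔ : 0 < delta M a r := delta_pos ha.le hr
    by_contra hneg
    push Not at hneg
    have : delta M a r * (conj (R r) * R' r).re < 0 := mul_neg_of_pos_of_neg hΔ hneg
    linarith
  · have h1 := sq_radialK_div_delta_le_of_threshold ha hω hx.1
    have h2 : ω ^ 2 * (x + rPlus M a) ^ 2 ≤ ω ^ 2 * (b + rPlus M a) ^ 2 := by
      have hx0 : 0 ≤ x + rPlus M a := by linarith [hx.1]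
      have hxb : x + rPlus M a ≤ b + rPlus M a := by linarith [hx.2]
      exact mul_le_mul_of_nonneg_left (pow_le_pow_left₀ hx0 hxb 2) (sq_nonneg ω)
    show 0 ≤ lam + a ^ 2 * ω ^ 2 - 2 * a * m * ω - radialK a ω m x ^ 2 / delta M a x
    linarith
  · refine (tendsto_delta_mul_re_conj_mul_deriv_horizonSolution ha hn).congr' ?_
    filter_upwards [self_mem_nhdsWithin] with y hy
    rw [hderiv y hy]

/-- **Weighted form, tree vocabulary of the near-extremal Kerr programme** (`Λ = λ + a²ω²`,
`u = (r² + a²)^{1/2} R`). At the threshold `ω = mω₊` (`|a| < M`, `m : ℤ`), for a classical solution of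
`Kerr.IsRadialTeukolskySolution M a 0 ω m (Λ − a²ω²)` normalised at `𝓗⁺`, and radii
`r₊ < r ≤ r′` with `ω²(r′ + r₊)² ≤ Λ − 2amω`:
`(r² + a²)^{1/2}|R(r)| ≤ (r′² + a²)^{1/2}|R(r′)|` (both factors are non-decreasing; in particular
`|u_𝓗| ≥ |u_𝓗(r₊)| = 1` all along the barrier). [folklore] -/
theorem norm_u_horizonSolution_le_of_threshold {M a ω Λ : ℝ} {m : ℤ} (ha : |a| < M) {R : ℝ → ℂ}
    (hsol : IsRadialTeukolskySolution M a 0 ω m (Λ - a ^ 2 * ω ^ 2) R)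
    (hn : IsNormalisedHorizonSolution M a 0 ω m R)
    (hω : ω = m * horizonAngularVelocity M a) {r r' : ℝ} (hr : rPlus M a < r) (hrr' : r ≤ r')
    (hb : ω ^ 2 * (r' + rPlus M a) ^ 2 ≤ Λ - 2 * a * m * ω) :
    Real.sqrt (r ^ 2 + a ^ 2) * ‖R r‖ ≤ Real.sqrt (r' ^ 2 + a ^ 2) * ‖R r'‖ := by
  have hM : 0 < M := lt_of_le_of_lt (abs_nonneg a) ha
  have hrp : 0 < rPlus M a := rPlus_pos hM a
  have hb' : ω ^ 2 * (r' + rPlus M a) ^ 2 ≤ (Λ - a ^ 2 * ω ^ 2) + a ^ 2 * ω ^ 2 - 2 * a * m * ω := by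
    linarith
  have hmono := norm_horizonSolution_monotoneOn_of_threshold ha hsol hn hω hb'
  have h1 : ‖R r‖ ≤ ‖R r'‖ := hmono ⟨hr, hrr'⟩ ⟨hr.trans_le hrr', le_rfl⟩ hrr'
  have h2 : Real.sqrt (r ^ 2 + a ^ 2) ≤ Real.sqrt (r' ^ 2 + a ^ 2) := by
    apply Real.sqrt_le_sqrt
    have hr0 : 0 ≤ r := (hrp.trans hr).le
    nlinarith
  exact mul_le_mul h2 h1 (norm_nonneg _) (Real.sqrt_nonneg _)

end Costa2019

end Literature.Geometry.Lorentzian.Kerr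

end
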